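import Summits.Ventures.PercRepro.GenQLargeSevenBase
import Summits.Ventures.PercRepro.GenQCoreChain
import Summits.Ventures.PercRepro.GenQLargeGenB

/-!
# PercRepro — THEOREM LARGE at rank `8`: `μ₈` for the core chain (night-4, gen 18)

The instance `q = 8` of `GenQLargeGenB` on the core chain `fCore = 3, 3, 3, 6, 10, 21, 43, 87, …`
(`sizeChain_core`): the coloop count by size is the explicit `mu8 = 8, 6, 5, 4, 3, 2, 1, 0` on
`j ≤ 8, = 9, ≤ 11, ≤ 14, ≤ 24, ≤ 45, ≤ 88, ≥ 89` (`muQ_eight`, by `decide` up to `88` and `muQ_eq_zero_of_forall`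
beyond).  The numerics `0 ≤ lbSumQ' 8 fCore t n` (`3 ≤ t ≤ 7`, `eightLargeBound t ≤ n ≤ 175`) are
`GenQLargeEightNumA … M`; the theorem of the `(10, 8)` cell, `jq_nonneg_of_large_eight`, is `GenQLargeEightAll`.
Imports `GenQLargeSevenBase` (`muQ_eq_zero_of_forall`), `GenQCoreChain`, `GenQLargeGenB`.
-/
namespace PercRepro.Night4

open Finset ThmH SixFour GenQ PerFlat Star NightThree

/-- `μ₈(j)` explicitly: `8, 6, 5, 4, 3, 2, 1, 0` on `j ≤ 8, = 9, ≤ 11, ≤ 14, ≤ 24, ≤ 45, ≤ 88, ≥ 89`. -/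
def mu8 (j : ℕ) : ℕ :=
  if j ≤ 8 then 8 else if j ≤ 9 then 6 else if j ≤ 11 then 5 else if j ≤ 14 then 4 else if j ≤ 24 then 3
  else if j ≤ 45 then 2 else if j ≤ 88 then 1 else 0

/-- **`muQ 8 fCore j = μ₈(j)`** at every `j`. -/
theorem muQ_eight (j : ℕ) : muQ 8 fCore j = mu8 j := by
  by_cases hj : j ≤ 88
  · interval_cases j <;> decide
  · rw [muQ_eq_zero_of_forall (by omega)]
    · unfold mu8
      simp only [show ¬ j ≤ 8 by omega, show ¬ j ≤ 9 by omega, show ¬ j ≤ 11 by omega, show ¬ j ≤ 14 by omega,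
        show ¬ j ≤ 24 by omega, show ¬ j ≤ 45 by omega, show ¬ j ≤ 88 by omega, if_false]
    · intro m hm1 hm2
      interval_cases m <;> simp [fCore] <;> omega

/-- The corank window of THEOREM LARGE at rank `8`: `|G| ≥ 54 / 56 / 60 / 71 / 91` at `t = 3 / 4 / 5 / 6 / 7`
(the first `n` with `0 ≤ lbSumQ' 8 fCore t n`; exact rationals, two implementations). -/
def eightLargeBound (t : ℕ) : ℕ :=
  if t ≤ 3 then 54 else if t ≤ 4 then 56 else if t ≤ 5 then 60 else if t ≤ 6 then 71 else 91

end PercRepro.Night4
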